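import Mathlib
import HarnessLib
import Summits.Ventures.LatticeQCDFlow.Exactness.NCMCGeneralSpaceMarkovRun

/-!
# The honest `ess` of the engine's restart chain: relative variance `2 τ_n(ρ_w) (1/ESS_F − 1) / n`, and `ΔF ≤ E ΔF̂_n`

HONEST FRAMING: exact (Metropolis-corrected) sampling algorithms for lattice gauge theory;
figures of merit are autocorrelation/cost numbers at stated couplings and volumes; no
continuum-physics claim.

Venture `LatticeQCDFlow` (cell pub-lqcd), topic `Exactness`; FANOUT row 13 (`eng-snf`, GEN-16).
NEW WORK of the cell, not a published result; no definition is introduced; nothing is cited as a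
fact.  `NCMCGeneralSpaceStationaryRun.lean` priced a STATIONARY stream of records abstractly;
`NCMCGeneralSpaceMarkovRun.lean` showed that the engine's restart chain of forward records (level
sampler `K` with `ν₀ ∘ K = ν₀`, record kernel `κF`, restart kernel `(κF ∘ₖ K).comap s`, started in
`P_F`) IS such a stream.  This file writes the two remaining stationary-stream statements for that
chain explicitly, so that the engine dictionary needs no assembly by the reader.

## Content (every `ν₀`-invariant Markov level sampler `K`, every `n ≥ 1`; no ergodicity needed)

* **`CrooksPair.freeEnergyDiff_le_integral_jarzynskiEstimate_restartChain`** — `ΔF ≤ E[ΔF̂_n]`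
  along the equilibrium restart chain (Jensen; the estimate assumed integrable).
* **`CrooksPair.variance_sampleMean_exp_neg_work_restartChain`** — with `e^{−W} ∈ L²(P_F)` and
  `Var_F[e^{−W}] ≠ 0`: the exponential average `Ȳ_n` of the restart chain has relative variance
  `Var[Ȳ_n]/(Z₁/Z₀)² = 2 τ_n(ρ_w) · (Var_F[e^{−W}]/(Z₁/Z₀)²) / n`, where `ρ_w(t)` is the lag-`t`
  autocorrelation of the WEIGHTS `e^{−W_i}` along the chain and `τ_n` row 11's `Scoring.tauIntN`;
  `Var_F[e^{−W}]/(Z₁/Z₀)² = 1/ESS_F − 1` (GEN-11) — so `run_ncmc_chain` with `n_between` sweeps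
  delivers `n/(2 τ_n(ρ_w))` independent evolutions' worth of `ess`, whatever `n_between` is.

NOT CLAIMED: any value or bound for `τ_n(ρ_w)` (that is what a larger `n_between` buys; row 8's
Doeblin files bound autocovariances of BOUNDED observables only).
-/

namespace Summit.Ventures.LatticeQCDFlow.Exactness.GeneralNCMC

open MeasureTheory ProbabilityTheory Set Filter Finset
open scoped ENNReal Topology

namespace CrooksPair

variable {Ω E : Type*} [MeasurableSpace Ω] [MeasurableSpace E]
variable {ν₀ ν₁ : Measure Ω} {κF κR : Kernel Ω E} {s e : E → Ω} {W : E → ℝ}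

/-- **`ΔF ≤ E[ΔF̂_n]` along the equilibrium restart chain**, for every `ν₀`-invariant level sampler
and every `n ≥ 1` (the estimate assumed integrable). -/
theorem freeEnergyDiff_le_integral_jarzynskiEstimate_restartChain (K : Kernel Ω Ω)
    [IsMarkovKernel K] [IsFiniteMeasure ν₀] [IsFiniteMeasure ν₁] [IsMarkovKernel κF]
    [IsMarkovKernel κR] (h0 : ν₀ univ ≠ 0) (hK : Kernel.Invariant K ν₀)
    (h : CrooksPair ν₀ ν₁ κF κR s e W) {ΔF : ℝ}
    (hΔF : Real.exp (-ΔF) = ((ν₀ univ)⁻¹ * ν₁ univ).toReal) {n : ℕ} (hn : 0 < n)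
    (hlog : haveI := isProbabilityMeasure_fwdPathLaw ν₀ h0 κF
      Integrable (fun x : ℕ → E =>
        Real.log (sampleMean (fun ε => Real.exp (-W ε)) (fun i : Fin n => x i)))
        (Kernel.trajMeasure (X := fun _ : ℕ => E) (fwdPathLaw ν₀ κF)
          (fun n : ℕ => ((κF ∘ₖ K).comap s h.measurable_s).comap
            (fun hh : (j : ↥(Finset.Iic n)) → E => hh ⟨n, Finset.mem_Iic.2 le_rfl⟩)
            (measurable_pi_apply _)))) :
    haveI := isProbabilityMeasure_fwdPathLaw ν₀ h0 κF
    ΔF ≤ ∫ x, jarzynskiEstimate (fun ε => Real.exp (-W ε)) (fun i : Fin n => x i)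
      ∂(Kernel.trajMeasure (X := fun _ : ℕ => E) (fwdPathLaw ν₀ κF)
        (fun n : ℕ => ((κF ∘ₖ K).comap s h.measurable_s).comap
          (fun hh : (j : ↥(Finset.Iic n)) → E => hh ⟨n, Finset.mem_Iic.2 le_rfl⟩)
          (measurable_pi_apply _))) := by
  haveI := isProbabilityMeasure_fwdPathLaw ν₀ h0 κF
  exact h.freeEnergyDiff_le_integral_jarzynskiEstimate_of_stationary h0 hΔF
    (h.measurePreserving_shift_restartChain K h0 hK) (h.restartChain_map_eval K h0 hK 0) hn hlog

/-- **The honest `ess` of the restart chain.**  Along the equilibrium restart chain of forward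
records (any `ν₀`-invariant Markov level sampler `K`), with `e^{−W} ∈ L²(P_F)` and
`Var_F[e^{−W}] ≠ 0`, the exponential average `Ȳ_n = (1/n) Σ_{i<n} e^{−W_i}` has relative variance
`Var[Ȳ_n] / (Z₁/Z₀)² = 2 τ_n(ρ_w) · (Var_F[e^{−W}] / (Z₁/Z₀)²) / n`, `ρ_w` the autocorrelation of
the weight stream of THIS chain and `τ_n` row 11's Fejér-weighted integrated autocorrelation time. -/
theorem variance_sampleMean_exp_neg_work_restartChain (K : Kernel Ω Ω) [IsMarkovKernel K]
    [IsFiniteMeasure ν₀] [IsMarkovKernel κF] [IsMarkovKernel κR] (h0 : ν₀ univ ≠ 0)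
    (hK : Kernel.Invariant K ν₀) (h : CrooksPair ν₀ ν₁ κF κR s e W)
    (hL2 : MemLp (fun ε => Real.exp (-W ε)) 2 (fwdPathLaw ν₀ κF))
    (hσ : Var[fun ε => Real.exp (-W ε); fwdPathLaw ν₀ κF] ≠ 0) {n : ℕ} (hn : n ≠ 0) :
    haveI := isProbabilityMeasure_fwdPathLaw ν₀ h0 κF
    Var[fun x : ℕ → E => (∑ i ∈ range n, Real.exp (-W (x i))) / n;
        Kernel.trajMeasure (X := fun _ : ℕ => E) (fwdPathLaw ν₀ κF)
          (fun n : ℕ => ((κF ∘ₖ K).comap s h.measurable_s).comap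
            (fun hh : (j : ↥(Finset.Iic n)) → E => hh ⟨n, Finset.mem_Iic.2 le_rfl⟩)
            (measurable_pi_apply _))] / ((ν₀ univ)⁻¹ * ν₁ univ).toReal ^ 2 =
      2 * Scoring.tauIntN (fun t => cov[fun x : ℕ → E => Real.exp (-W (x 0)),
          fun x : ℕ → E => Real.exp (-W (x t));
          Kernel.trajMeasure (X := fun _ : ℕ => E) (fwdPathLaw ν₀ κF)
            (fun n : ℕ => ((κF ∘ₖ K).comap s h.measurable_s).comap
              (fun hh : (j : ↥(Finset.Iic n)) → E => hh ⟨n, Finset.mem_Iic.2 le_rfl⟩)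
              (measurable_pi_apply _))] /
          Var[fun ε => Real.exp (-W ε); fwdPathLaw ν₀ κF]) n *
        (Var[fun ε => Real.exp (-W ε); fwdPathLaw ν₀ κF] /
          (∫ ε, Real.exp (-W ε) ∂(fwdPathLaw ν₀ κF)) ^ 2) / n := by
  haveI := isProbabilityMeasure_fwdPathLaw ν₀ h0 κF
  exact h.variance_sampleMean_exp_neg_work_of_stationary hL2 hσ
    (h.measurePreserving_shift_restartChain K h0 hK) (h.restartChain_map_eval K h0 hK 0) hn

end CrooksPair

end Summit.Ventures.LatticeQCDFlow.Exactness.GeneralNCMC
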